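import Mathlib
import Summits.NavierStokesRegularity.NavierStokesRegularity.Theorems.FilamentSkeletonRssStadiumFootTangential
import Summits.NavierStokesRegularity.NavierStokesRegularity.Theorems.FilamentSkeletonRssStadiumLegProfiles
import Summits.NavierStokesRegularity.NavierStokesRegularity.Theorems.FilamentSkeletonRssStadiumPartnerPiece

/-!
# Route `FilamentSkeletonRss` · child crux `TangentSkeletonNearStraightL` (stmt-NavierStokesRegularity-23320) · registered line
# `child_tangent_analytic_strip_L` (b0b56c52900dd90a), stub `stub_stripPropagation` — assembly piece: THE FOOT ESTIMATE FOR A BARE REAL SOURCE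

Item R2 of the remaining list of the quarter-width blueprint (evidence `CORNER-QUARTER-BLUEPRINT-leafhand-15-g0.md` v4 on 23320): a source
point on the REAL AXIS, possibly outside the stadium (the unshifted part of the own-filament contour, `F(ζ)` replaced by the real value
`X(x₂)`), against a target `z = x₁ + iY` in the stadium.  Only the target's vertical leg carries smears:
* `re_chord_sq_ge_bare_foot` (abstract, `U` open): `(c₀ − J₁)² − (Y + I₁)² ≤ Re Σᵢ (Fᵢ(x₁+iY) − X₂ᵢ)²`, `J₁ = ∫₀^Y q₁e₁` (tangential smear,
  second order by `Re F′ ⊥ Im F′`), `I₁ = ∫₀^Y e₁`, `c₀ ≤ Σ (X₂ − X₁)ᵢ T₁ᵢ`;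
* `bare_foot_re_ge_closed_form` (stub terms): the same with the stadium's leg profiles (`Theorems.StadiumLegProfiles`, radius `R₁`, `‖F′‖ ≤ M`)
  and `I₁`, `J₁` in closed form.
HONEST FRAMING: bookkeeping for a HYPOTHETICAL filament skeleton on the NEGATIVE side of a MODEL route; the stub `stub_stripPropagation` is NOT
closed by this file; nothing here bears on Navier–Stokes regularity or blow-up.  `--supports stmt-NavierStokesRegularity-23320`.
-/

set_option linter.dupNamespace false

noncomputable section

namespace Summit.NavierStokesRegularity.NavierStokesRegularity.Theorems.StadiumFootBare

open Set MeasureTheory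
open scoped InnerProductSpace BigOperators
open Summit.NavierStokesRegularity.NavierStokesRegularity.Theorems.StadiumFootTangential
open Summit.NavierStokesRegularity.NavierStokesRegularity.Theorems.StadiumPairPositivity
open Summit.NavierStokesRegularity.NavierStokesRegularity.Theorems.StadiumLegProfiles
open Summit.NavierStokesRegularity.NavierStokesRegularity.Theorems.StadiumDeviationPackage
open Summit.NavierStokesRegularity.NavierStokesRegularity.Theorems.StadiumPartnerPiece

/-- **Foot estimate for a bare real source.**  `F : ℂ → ℂ³` complex-differentiable on an open `U` with `Σ (F′)ᵢ² = 1`; a target foot `x₁`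
with leg `x₁ + i[0,Y] ⊆ U`, `F(x₁) = X₁` real, a real unit tangent `T₁`; a real source value `X₂ : ℝ³`; `c₀ ≤ Σ (X₂ − X₁)ᵢ T₁ᵢ`; continuous
profiles `‖Im F′‖ ≤ q₁`, `‖Re F′ − T₁‖ ≤ e₁` on the leg.  If `0 ≤ c₀ − ∫₀^Y q₁e₁` then
`(c₀ − ∫₀^Y q₁(e₁+0))² − (Y + ∫₀^Y e₁)² ≤ Re Σᵢ (Fᵢ(x₁+iY) − X₂ᵢ)²`. [folklore] -/
theorem re_chord_sq_ge_bare_foot {U : Set ℂ} (hU : IsOpen U) {F : ℂ → (Fin 3 → ℂ)} (hF : DifferentiableOn ℂ F U)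
    (hunit : ∀ w ∈ U, ∑ i, (deriv F w i) ^ 2 = 1) {x₁ Y : ℝ} (hY : 0 ≤ Y)
    (hmem₁ : ∀ u ∈ Icc (0:ℝ) Y, (x₁ : ℂ) + (u : ℂ) * Complex.I ∈ U)
    (X₁ X₂ : Fin 3 → ℝ) (hX₁ : ∀ i, F (x₁ : ℂ) i = (X₁ i : ℂ))
    (T₁ : Fin 3 → ℝ) (hT₁ : ∑ i, T₁ i ^ 2 = 1) {c₀ : ℝ} (hc₀ : c₀ ≤ ∑ i, (X₂ i - X₁ i) * T₁ i)
    {q₁ e₁ : ℝ → ℝ} (hq₁c : Continuous q₁) (he₁c : Continuous e₁)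
    (hq₁ : ∀ u ∈ Icc (0:ℝ) Y, √(∑ i, (deriv F ((x₁ : ℂ) + (u : ℂ) * Complex.I) i).im ^ 2) ≤ q₁ u)
    (he₁ : ∀ u ∈ Icc (0:ℝ) Y, √(∑ i, ((deriv F ((x₁ : ℂ) + (u : ℂ) * Complex.I) i).re - T₁ i) ^ 2) ≤ e₁ u)
    (ha : 0 ≤ c₀ - ∫ u in (0:ℝ)..Y, q₁ u * (e₁ u + 0)) :
    (c₀ - ∫ u in (0:ℝ)..Y, q₁ u * (e₁ u + 0)) ^ 2 - (Y + ∫ u in (0:ℝ)..Y, e₁ u) ^ 2 ≤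
      (∑ i, (F ((x₁ : ℂ) + (Y : ℂ) * Complex.I) i - (X₂ i : ℂ)) ^ 2).re := by
  set z₁ : ℂ := (x₁ : ℂ) + (Y : ℂ) * Complex.I with hz₁
  set v : Fin 3 → ℂ := fun i => F z₁ i - (X₂ i : ℂ) with hv
  have hρ₁₁ : √(∑ i, (T₁ i - T₁ i) ^ 2) ≤ 0 := by simp
  have hP₁ := abs_re_proj_vertical_sub_le hU hF hunit hY hmem₁ T₁ T₁ hρ₁₁ hq₁c he₁c hq₁ he₁
  have hreal₁ : ∀ i, (F (x₁ : ℂ) i).im = 0 := fun i => by rw [hX₁ i]; exact Complex.ofReal_im _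
  have hV₁ := euclid_im_vertical_sub_linear_le hU hF hY hmem₁ hreal₁ T₁ he₁c he₁
  set J₁ : ℝ := ∫ u in (0:ℝ)..Y, q₁ u * (e₁ u + 0) with hJ₁
  set I₁ : ℝ := ∫ u in (0:ℝ)..Y, e₁ u with hI₁
  -- projection of the real part
  have hre_decomp : ∑ i, (v i).re * T₁ i =
      (∑ i, ((F z₁ i).re - (F (x₁ : ℂ) i).re) * T₁ i) - ∑ i, (X₂ i - X₁ i) * T₁ i := by
    have h1 : ∀ i, (F (x₁ : ℂ) i).re = X₁ i := fun i => by rw [hX₁ i]; exact Complex.ofReal_re _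
    simp only [hv, Complex.sub_re, Complex.ofReal_re, h1, ← Finset.sum_sub_distrib]
    exact Finset.sum_congr rfl fun i _ => by ring
  have hproj : c₀ - J₁ ≤ |∑ i, (v i).re * T₁ i| := by
    rw [hre_decomp]
    have h1 := abs_le.1 hP₁
    have h3 : c₀ - J₁ ≤ -((∑ i, ((F z₁ i).re - (F (x₁ : ℂ) i).re) * T₁ i) - ∑ i, (X₂ i - X₁ i) * T₁ i) := by
      rw [hJ₁]; linarith
    exact h3.trans (neg_le_abs _)
  -- imaginary part
  have him : √(∑ i, (v i).im ^ 2) ≤ Y + I₁ := by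
    refine euclid_norm_le_of_forall_dot_le _ fun ℓ hℓ => ?_
    have hsplit : ∑ i, (v i).im * ℓ i = (∑ i, ((F z₁ i).im - Y * T₁ i) * ℓ i) + Y * ∑ i, T₁ i * ℓ i := by
      simp only [hv, Complex.sub_im, Complex.ofReal_im, sub_zero, Finset.mul_sum, ← Finset.sum_add_distrib]
      exact Finset.sum_congr rfl fun i _ => by ring
    have hcs : ∀ w : Fin 3 → ℝ, ∑ i, w i * ℓ i ≤ √(∑ i, w i ^ 2) := fun w => by
      have h := sum_mul_le_sqrt_mul_sqrt w ℓ
      rwa [hℓ, Real.sqrt_one, mul_one] at h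
    have h1 := (hcs fun i => (F z₁ i).im - Y * T₁ i).trans hV₁
    have h2 : ∑ i, T₁ i * ℓ i ≤ 1 := by
      have h := hcs T₁
      rwa [hT₁, Real.sqrt_one] at h
    have h3 : Y * ∑ i, T₁ i * ℓ i ≤ Y := by nlinarith
    rw [hsplit]
    linarith
  have hmain := re_sum_sq_ge_of_proj v T₁ hT₁ (by rw [hJ₁] at ha ⊢; exact ha) hproj him
  simpa only [hv] using hmain

/-- **Bare-foot estimate in the stub's terms, closed form.**  Stadium `S`, `F` holomorphic with `‖F′‖ ≤ M`, `Σ (F′)ᵢ² = 1`, `F = cplx ∘ X`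
on the real trace (`X` differentiable, unit speed, oscillation `≤ Rb`); target foot `x₁` with height `0 ≤ Y < R₁`, radius `R₁ < hs`,
`|x₁ − cc| + R₁ < L + hs`; ANY real source parameter `x₂` (in or outside the stadium); `c₀ ≤ Σ (X(x₂) − X(x₁))ᵢ X′(x₁)ᵢ`.  With
`ℓ₁ = log(R₁/(R₁−Y))`, `I₁ = √3·2M(Y − (R₁−Y)ℓ₁ − Y²/(2R₁))`, `J₁ = 6M²(2Y − (R₁−Y)ℓ₁² − 2(R₁−Y)ℓ₁ + (R₁²−Y²)ℓ₁/(2R₁) − Y/2 − Y²/(4R₁))`: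
if `0 ≤ c₀ − J₁` then `(c₀ − J₁)² − (Y + I₁)² ≤ Re Σᵢ (Fᵢ(x₁+iY) − X(x₂)ᵢ)²`. [folklore] -/
theorem bare_foot_re_ge_closed_form {hs L cc M : ℝ} {F : ℂ → (Fin 3 → ℂ)}
    (hF : DifferentiableOn ℂ F {z : ℂ | |z.im| < hs ∧ |z.re - cc| < L + hs})
    (hM : ∀ z ∈ {z : ℂ | |z.im| < hs ∧ |z.re - cc| < L + hs}, ‖deriv F z‖ ≤ M)
    (hunit : ∀ w ∈ {z : ℂ | |z.im| < hs ∧ |z.re - cc| < L + hs}, ∑ i, (deriv F w i) ^ 2 = 1)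
    {X : ℝ → EuclideanSpace ℝ (Fin 3)} (hX : Differentiable ℝ X) (hXu : ∀ τ, ‖deriv X τ‖ = 1)
    {Rb : ℝ} (hosc : ∀ τ σ, ‖deriv X τ - deriv X σ‖ ≤ Rb)
    (hFX : ∀ r : ℝ, (r : ℂ) ∈ {z : ℂ | |z.im| < hs ∧ |z.re - cc| < L + hs} →
      F r = fun i => ((⟪X r, EuclideanSpace.single i (1:ℝ)⟫_ℝ : ℝ) : ℂ))
    (hhs : 0 < hs) {x₁ x₂ Y R₁ : ℝ} (hY : 0 ≤ Y) (hR₁Y : Y < R₁) (hR₁hs : R₁ < hs) (hR₁end : |x₁ - cc| + R₁ < L + hs)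
    {c₀ : ℝ} (hc₀ : c₀ ≤ ∑ i, (⟪X x₂, EuclideanSpace.single i (1:ℝ)⟫_ℝ - ⟪X x₁, EuclideanSpace.single i (1:ℝ)⟫_ℝ) *
      ⟪deriv X x₁, EuclideanSpace.single i (1:ℝ)⟫_ℝ)
    (ha : 0 ≤ c₀ - 6 * M ^ 2 * (2 * Y - (R₁ - Y) * Real.log (R₁ / (R₁ - Y)) ^ 2 - 2 * (R₁ - Y) * Real.log (R₁ / (R₁ - Y)) +
        (R₁ ^ 2 - Y ^ 2) * Real.log (R₁ / (R₁ - Y)) / (2 * R₁) - Y / 2 - Y ^ 2 / (4 * R₁))) :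
    (c₀ - 6 * M ^ 2 * (2 * Y - (R₁ - Y) * Real.log (R₁ / (R₁ - Y)) ^ 2 - 2 * (R₁ - Y) * Real.log (R₁ / (R₁ - Y)) +
        (R₁ ^ 2 - Y ^ 2) * Real.log (R₁ / (R₁ - Y)) / (2 * R₁) - Y / 2 - Y ^ 2 / (4 * R₁))) ^ 2
      - (Y + √3 * (2 * M * (Y - (R₁ - Y) * Real.log (R₁ / (R₁ - Y)) - Y ^ 2 / (2 * R₁)))) ^ 2 ≤
      (∑ i, (F ((x₁ : ℂ) + (Y : ℂ) * Complex.I) i - ((⟪X x₂, EuclideanSpace.single i (1:ℝ)⟫_ℝ : ℝ) : ℂ)) ^ 2).re := by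
  set S : Set ℂ := {z : ℂ | |z.im| < hs ∧ |z.re - cc| < L + hs} with hS
  have hSo : IsOpen S := isOpen_stadium hs (L + hs) cc
  have hx₁ : |x₁ - cc| < L + hs := by linarith
  have hR₁ : 0 < R₁ := lt_of_le_of_lt hY hR₁Y
  have hmem₁ : ∀ u ∈ Icc (0:ℝ) Y, (x₁ : ℂ) + (u : ℂ) * Complex.I ∈ S := by
    intro u hu
    refine ⟨?_, ?_⟩
    · simp only [Complex.add_im, Complex.ofReal_im, Complex.mul_im, Complex.ofReal_re, Complex.I_im, Complex.I_re,
        mul_one, mul_zero, zero_add, add_zero]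
      rw [abs_of_nonneg hu.1]; linarith [hu.2]
    · simp only [Complex.add_re, Complex.ofReal_re, Complex.mul_re, Complex.ofReal_im, Complex.I_re, Complex.I_im,
        mul_zero, mul_one, sub_zero, add_zero]
      exact hx₁
  set X₁ : Fin 3 → ℝ := fun i => ⟪X x₁, EuclideanSpace.single i (1:ℝ)⟫_ℝ with hX₁
  set X₂ : Fin 3 → ℝ := fun i => ⟪X x₂, EuclideanSpace.single i (1:ℝ)⟫_ℝ with hX₂
  set T₁ : Fin 3 → ℝ := fun i => ⟪deriv X x₁, EuclideanSpace.single i (1:ℝ)⟫_ℝ with hT₁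
  have hFx₁ : ∀ i, F (x₁ : ℂ) i = (X₁ i : ℂ) := fun i => by
    rw [hFX x₁ ⟨by simpa using hhs, by simpa using hx₁⟩]
  have hT₁u : ∑ i, T₁ i ^ 2 = 1 := (unit_tangent_coords hXu hosc x₁ x₁).1
  obtain ⟨hq₁, he₁⟩ := leg_profiles hF hM hX hFX hhs hR₁ hR₁hs hR₁end hR₁Y
  have hq₁c := continuous_legQ M hY hR₁Y
  have he₁c := continuous_legE M hY hR₁Y
  have hI₁ : ∫ u in (0:ℝ)..Y, √3 * (2 * M * (Real.log (R₁ / (R₁ - max 0 (min u Y))) - max 0 (min u Y) / R₁)) =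
      √3 * (2 * M * (Y - (R₁ - Y) * Real.log (R₁ / (R₁ - Y)) - Y ^ 2 / (2 * R₁))) := integral_legE_clamp_eq M hY hR₁Y
  have hJ₁ : ∫ u in (0:ℝ)..Y, √3 * (M * Real.log (R₁ / (R₁ - max 0 (min u Y)))) *
      (√3 * (2 * M * (Real.log (R₁ / (R₁ - max 0 (min u Y))) - max 0 (min u Y) / R₁)) + 0) =
      6 * M ^ 2 * (2 * Y - (R₁ - Y) * Real.log (R₁ / (R₁ - Y)) ^ 2 - 2 * (R₁ - Y) * Real.log (R₁ / (R₁ - Y)) +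
        (R₁ ^ 2 - Y ^ 2) * Real.log (R₁ / (R₁ - Y)) / (2 * R₁) - Y / 2 - Y ^ 2 / (4 * R₁)) := by
    rw [← integral_legQE_eq M hY hR₁Y]
    refine intervalIntegral.integral_congr fun u hu => ?_
    rw [uIcc_of_le hY] at hu
    simp only [clamp_eq hu, add_zero]
  have h := re_chord_sq_ge_bare_foot hSo hF hunit hY hmem₁ X₁ X₂ hFx₁ T₁ hT₁u hc₀ hq₁c he₁c hq₁ he₁
    (by rw [hJ₁]; exact ha)
  rw [hJ₁, hI₁] at h
  exact h

end Summit.NavierStokesRegularity.NavierStokesRegularity.Theorems.StadiumFootBare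

end
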